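import Literature.Analysis.SpecialFunctions.GammaStirlingUniform
import Literature.Analysis.SpecialFunctions.GammaVerticalBounds
import Literature.NumberTheory.LFunctions.WeilExplicitDirichlet
import Literature.NumberTheory.LFunctions.RiemannXiOrderProofs
import Mathlib.Analysis.SpecialFunctions.Gamma.BohrMollerup
import Mathlib.Analysis.Complex.ExponentialBounds
import Mathlib.Analysis.Real.Pi.Bounds
import HarnessLib

/-!
# Platt 2016, Lemma 8.3: the explicit bound for the Gamma factor `|Γ((1/2+it+a_χ)/2)| e^{πt/4}`

Topic `Literature/NumberTheory/LFunctions`; namespace `Literature.NumberTheory.LFunctions`, engine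
sub-namespace `GammaFactorBound`. Companion of `CertifiedLFunctionGaussianWindow.lean` (Lemma 8.4),
`CertifiedLFunctionWindowAliasingBound.lean` (Lemma 8.5), `CertifiedLFunctionCriticalLineBound.lean`
(Lemma 7.3) and `CertifiedLFunctionUpsampling.lean` (Theorems 8.1–8.2): the §8 "Rigorous up-sampling"
error analysis of D. J. Platt, *Numerical computations concerning the GRH*, Math. Comp. **85** (2016)
3009–3027 [Platt2016GRH] (journal pdf p. 3021 read this session; arXiv:1305.3087v1, there Lemma 6.3
p. 12). Typed for the parity-realchar cell (D-0088 (4) literature-typing layer, row «Platt 2016»);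
everything here is PROVED (kernel lane): no definitions, no named facts.

## The statement (p. 3021, verbatim)

> **Lemma 8.3.** For `a_χ ∈ {0, 1}`,
> `|Γ((1/2 + it + a_χ)/2)| e^{πt/4} ≤ max( √π (3 + max(2t, 0))^{1/4} e^{1/6}, √(2π) exp(π/8 + 1/4) )`.
> *Proof.* We use Stirling's approximation separately for `a_χ = 0` and `a_χ = 1`. □

(arXiv v1 prints the first term as `2^{1/4} √π (3/2 + max(t,0))^{1/4} exp(1/6)`, the same number —
`platt2016_lemma83_arxiv`.) This is the Gamma-side input of Lemma 8.7 (the up-sampling error `E` for the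
Gaussian-windowed `W(t, χ) = Λ_χ(t) exp(−(t−t₀)²/(2h²))`, with
`Λ_χ(t) = ε_χ (q/π)^{it/2} Γ((1/2+a_χ+it)/2) e^{πt/4} L_χ(1/2+it)`, p. 3009), together with Lemma 7.3
(`platt2016_lemma73`) and Lemma 8.6. Numerically `√(2π)e^{π/8+1/4} = 4.7666…`; the true supremum of the
left side is `≈ 3.95` for `a_χ = 0` (near `t ≈ 0.25`) and the left side is `~ √π (2t)^{1/4}` for
`a_χ = 1`, `t → +∞`, so the printed first term is sharp up to the factor `e^{1/6}` (cf. the classical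
`|Γ(z)| ≤ √(2π) |z|^{x−1/2} e^{−π|y|/2} e^{1/(6|z|)}`, `x ≥ 0`, DLMF 5.6.9).

## Main results

* `platt2016_lemma83` — **Lemma 8.3 as printed**, for `a : ℕ`, `a ≤ 1`, all real `t`
  (`Γ` = `Complex.Gamma`, `x^{1/4}` = `Real.rpow`); `platt2016_lemma83_arxiv` (arXiv form of the
  constant), `platt2016_lemma83_even` / `_odd` (`Γ((1/2+it)/2)`, `Γ((3/2+it)/2)`),
  `platt2016_lemma83_charParity` (`a = charParity χ`, argument order of `platt2016_lemma85`),
  `platt2016_lemma83_of_nonneg` (`t ≥ 0`: `max(2t,0) = 2t`).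
* Engine (`GammaFactorBound.*`, reusable for Lemma 7.6 / Booker's Lemma 5.7-type bounds):
  `log_norm_Gamma_add_le` — for `σ > 0`, `τ ≥ 0`, `w = σ+iτ`:
  `log|Γ(w)| + πτ/2 ≤ (σ−½)log|w| + ½log 2π + (1/12)(1/|w|² + π/(2|w|))` (the Stirling branch);
  `norm_Gamma_eq_shift_two` / `norm_Gamma_le_shift_two` — `|Γ(σ+iτ)| ≤ Γ(σ+2)/(|w||w+1|)`;
  `cell` (one rational mesh cell), `norm_Gamma_mul_exp_le_of_nonpos` (`t ≤ 0`),
  `odd_of_two_le` (`|Γ(3/4+it/2)|e^{πt/4} ≤ √π(3+2t)^{1/4}e^{1/6}` for `t ≥ 2`), `even_of_two_le`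
  (`|Γ(1/4+it/2)|e^{πt/4} ≤ √(2π)e^{π/8+1/4}` for `t ≥ 2`), `even_of_le_two` / `odd_of_le_two`
  (`≤ 4.76` on `0 ≤ t ≤ 2`), `const_ge` (`4.76 ≤ √(2π)e^{π/8+1/4}`), `exp_le_taylor` /
  `exp_pi_mul_le` (private rational enclosures of `e^x`).

## Proof (the printed proof is the one line above; this is its explicit execution)

Write `w = σ + it/2`, `σ = (1/2 + a)/2 ∈ {1/4, 3/4}`.
1. `t ≤ 0`: `|Γ(w)| ≤ Γ(σ)` (the tree's `GammaVert.norm_Gamma_le_Gamma_re`) `≤ 1/σ ≤ 4` (convexity of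
   `Γ`, Mathlib `Real.convexOn_Gamma`, gives `Γ ≤ 1` on `[1, 2]`), `e^{πt/4} ≤ 1`, and `4 ≤ 4.76 ≤
   √(2π)e^{π/8+1/4}` (`const_ge`, from `π > 3.141592` and the exponential series).
2. `t ≥ 2`, Stirling: the tree's uniform Stirling formula on `Re w > 0`
   (`GammaStirling.abs_log_norm_Gamma_sub_le`, remainder `R(w) = (1/12)(1/|w|² + π/(2|w|))`) gives
   `log|Γ(w)| ≤ (σ−½)log|w| − (t/2)·arg w − σ + ½log 2π + R(w)`; and `(t/2)(π/2 − arg w) ≤ σ` because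
   `φ = π/2 − arg w ∈ [0, π/2)` has `tan φ = σ/(t/2)` (`Complex.tan_arg`) and `φ ≤ tan φ`
   (`Real.le_tan`). For `σ = 3/4`: `|w| ≥ 5/4` so `R ≤ (1/12)(16/25 + 2π/5) < 1/6`, and `|w| ≤ (3+2t)/4`,
   whence `≤ ((3+2t)/4)^{1/4} √(2π) e^{1/6} = √π (3+2t)^{1/4} e^{1/6}`. For `σ = 1/4`: `|w| ≥ 1` so
   `−¼log|w| ≤ 0` and `R ≤ (1+π/2)/12 ≤ π/8 + 1/4`, whence `≤ √(2π) e^{π/8+1/4}`.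
3. `0 ≤ t ≤ 2`, elementary: `Γ(w) = Γ(w+2)/(w(w+1))` (`Complex.Gamma_add_one` twice), `|Γ(w+2)| ≤
   Γ(σ+2) ≤ σ+1`; on a cell `u ≤ t ≤ v` each factor is monotone, so it suffices that
   `((σ+1)E_v)² ≤ 4.76² (σ²+u²/4)((σ+1)²+u²/4)` with a rational `E_v ≥ e^{πv/4}` (`π < 3.1416` and
   `e^x ≤ Σ_{m<5} x^m/m! + x⁵/100` on `[0,1]`, Mathlib `Real.exp_bound'`; `e ≤ 2.7182818286`):
   nine cells for `σ = 1/4` (breakpoints `0, .2, .3, .4, .55, .74, 1, 1.3, 1.65, 2`), two for `σ = 3/4`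
   (`0, 1.5, 2`), each closed by `norm_num` on rationals (margins ≥ 0.4 %, pre-checked exactly).

`lean search` (2026-08-27): "Lemma 8.3", `lemma83`, `|Γ((1/2+it+a)/2)| e^{πt/4}` bounds occur only as
"NOT here" notes in the §8 companions; reused: `GammaStirling.abs_log_norm_Gamma_sub_le`
(`GammaStirlingUniform.lean`), `GammaVert.norm_Gamma_le_Gamma_re` (`GammaVerticalBounds.lean`),
`Real.Gamma_le_one_of_mem_Icc` (`RiemannXiOrderProofs.lean`: `Γ ≤ 1` on `[1, 2]` by convexity),
`charParity`/`charParity_le_one` (`WeilExplicitDirichlet.lean`); Mathlib: `Real.convexOn_Gamma`,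
`Real.Gamma_two`, `Complex.Gamma_add_one`, `Complex.norm_add_mul_I`, `Complex.tan_arg`,
`Complex.abs_arg_lt_pi_div_two_iff`, `Real.le_tan`, `Real.exp_bound'`, `Real.sum_le_exp_of_nonneg`,
`Real.exp_one_lt_d9`, `Real.pi_gt_d6`, `Real.pi_lt_d4`. Nothing here duplicates a tree declaration.

NOT here: Lemma 8.6 (the geometric majorant `G(n)`; as printed it needs a monotonicity hypothesis on
`G(n+1)/G(n)`), Lemma 8.7 ("for large enough `t₀`"), Lemma 7.6 (= Booker 2006 Lemma 5.7 with Lemma 7.3).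

## References

* [Platt2016GRH] D. J. Platt, *Numerical computations concerning the GRH*, Math. Comp. 85 (2016),
  no. 302, 3009–3027, doi:10.1090/mcom/3077 — §8 Lemma 8.3 p. 3021 (journal numbering; =
  arXiv:1305.3087v1 Lemma 6.3 p. 12).
* E. T. Whittaker, G. N. Watson, *A Course of Modern Analysis*, 4th ed. (1927), §12.33, §13.6
  (Stirling / Binet, via `GammaStirlingUniform.lean`).
-/

noncomputable section

open Complex Real Set

namespace Literature.NumberTheory.LFunctions

namespace GammaFactorBound

open Literature.Analysis.SpecialFunctions.GammaStirling (abs_log_norm_Gamma_sub_le)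

/-! ### The constants `Γ(σ) ≤ 1/σ`, `Γ(σ+2) ≤ σ+1` (from the tree's `Real.Gamma_le_one_of_mem_Icc`: `Γ ≤ 1` on `[1, 2]`) -/

/-- `Γ(σ) ≤ 1/σ` for `0 < σ ≤ 1` (the recurrence `Γ(σ+1) = σΓ(σ)` and `Γ ≤ 1` on `[1, 2]`).
[cite: DLMF, Eq. 5.5.1] -/
theorem Gamma_le_one_div {σ : ℝ} (h0 : 0 < σ) (h1 : σ ≤ 1) : Real.Gamma σ ≤ 1 / σ := by
  have h := Real.Gamma_add_one h0.ne'
  have hle : Real.Gamma (σ + 1) ≤ 1 := Real.Gamma_le_one_of_mem_Icc (by linarith) (by linarith)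
  rw [h] at hle
  rw [le_div_iff₀ h0]
  linarith [mul_comm σ (Real.Gamma σ)]

/-- `Γ(σ+2) ≤ σ+1` for `0 < σ ≤ 1` (the recurrence `Γ(σ+2) = (σ+1)Γ(σ+1)` and `Γ ≤ 1` on `[1, 2]`).
[cite: DLMF, Eq. 5.5.1] -/
theorem Gamma_add_two_le {σ : ℝ} (h0 : 0 < σ) (h1 : σ ≤ 1) : Real.Gamma (σ + 2) ≤ σ + 1 := by
  have h := Real.Gamma_add_one (s := σ + 1) (by linarith)
  rw [show σ + 1 + 1 = σ + 2 by ring] at h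
  rw [h]
  have hle := Real.Gamma_le_one_of_mem_Icc (x := σ + 1) (by linarith) (by linarith)
  have hpos : 0 < σ + 1 := by linarith
  nlinarith

/-! ### The two-step shift `Γ(w) = Γ(w+2)/(w(w+1))` and the elementary bound for small `|Im w|` -/

/-- `‖Γ(σ+iτ)‖ = ‖Γ(σ+2+iτ)‖ / (‖σ+iτ‖ ‖σ+1+iτ‖)` for `σ > 0` (the recurrence `Γ(z+1) = zΓ(z)`
twice, Mathlib `Complex.Gamma_add_one`). [cite: DLMF, Eq. 5.5.1] -/
theorem norm_Gamma_eq_shift_two {σ : ℝ} (hσ : 0 < σ) (τ : ℝ) :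
    ‖Complex.Gamma (σ + τ * I)‖ =
      ‖Complex.Gamma (((σ + 2 : ℝ) : ℂ) + τ * I)‖ / (‖(σ : ℂ) + τ * I‖ * ‖((σ + 1 : ℝ) : ℂ) + τ * I‖) := by
  set w : ℂ := σ + τ * I with hw
  have hre : w.re = σ := by simp [hw]
  have hw0 : w ≠ 0 := fun h => by
    have := congrArg Complex.re h; rw [hre] at this; simp at this; linarith
  have hre1 : (w + 1).re = σ + 1 := by simp [hw]
  have hw1 : w + 1 ≠ 0 := fun h => by
    have := congrArg Complex.re h; rw [hre1] at this; simp at this; linarith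
  have h1 : Complex.Gamma (w + 1) = w * Complex.Gamma w := Complex.Gamma_add_one w hw0
  have h2 : Complex.Gamma (w + 1 + 1) = (w + 1) * Complex.Gamma (w + 1) :=
    Complex.Gamma_add_one _ hw1
  have hcast2 : ((σ + 2 : ℝ) : ℂ) + τ * I = w + 1 + 1 := by simp only [hw]; push_cast; ring
  have hcast1 : ((σ + 1 : ℝ) : ℂ) + τ * I = w + 1 := by simp only [hw]; push_cast; ring
  rw [hcast2, hcast1, h2, h1, norm_mul, norm_mul]
  have hn0 : ‖w‖ ≠ 0 := norm_ne_zero_iff.mpr hw0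
  have hn1 : ‖w + 1‖ ≠ 0 := norm_ne_zero_iff.mpr hw1
  field_simp

/-- `‖Γ(σ+iτ)‖ ≤ Γ(σ+2) / (√(σ²+τ²) √((σ+1)²+τ²))` for `σ > 0`: the two-step shift and
`|Γ(x+iy)| ≤ Γ(x)` (`x > 0`; the tree's `GammaVert.norm_Gamma_le_Gamma_re`).
[cite: DLMF, Eq. 5.5.1 and Eq. 5.6.6] -/
theorem norm_Gamma_le_shift_two {σ : ℝ} (hσ : 0 < σ) (τ : ℝ) :
    ‖Complex.Gamma (σ + τ * I)‖ ≤
      Real.Gamma (σ + 2) / (Real.sqrt (σ ^ 2 + τ ^ 2) * Real.sqrt ((σ + 1) ^ 2 + τ ^ 2)) := by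
  rw [norm_Gamma_eq_shift_two hσ τ]
  have hG : ‖Complex.Gamma (((σ + 2 : ℝ) : ℂ) + τ * I)‖ ≤ Real.Gamma (σ + 2) :=
    Literature.Analysis.SpecialFunctions.GammaVert.norm_Gamma_le_Gamma_re (by linarith) τ
  have hn0 : ‖(σ : ℂ) + τ * I‖ = Real.sqrt (σ ^ 2 + τ ^ 2) := Complex.norm_add_mul_I σ τ
  have hn1 : ‖((σ + 1 : ℝ) : ℂ) + τ * I‖ = Real.sqrt ((σ + 1) ^ 2 + τ ^ 2) :=
    Complex.norm_add_mul_I (σ + 1) τ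
  rw [hn0, hn1]
  have h1 : 0 < Real.sqrt (σ ^ 2 + τ ^ 2) := Real.sqrt_pos.mpr (by positivity)
  have h2 : 0 < Real.sqrt ((σ + 1) ^ 2 + τ ^ 2) := Real.sqrt_pos.mpr (by positivity)
  exact div_le_div_of_nonneg_right hG (mul_pos h1 h2).le

/-- **One mesh cell.** For `0 < σ ≤ 1`, `0 ≤ u ≤ t ≤ v`, an upper bound `E ≥ e^{πv/4}` and `K ≥ 0` with
`((σ+1)E)² ≤ K² (σ²+u²/4)((σ+1)²+u²/4)`: `‖Γ(σ+it/2)‖ e^{πt/4} ≤ K` (from `norm_Gamma_le_shift_two`,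
`Γ(σ+2) ≤ σ+1` and monotonicity in `t` of each factor) — the elementary branch of the proof of
Platt's Lemma 8.3 on `0 ≤ t ≤ 2`. [cite: Platt2016GRH, Lemma 8.3 p. 3021 (proof, case 0 ≤ t ≤ 2)] -/
theorem cell {σ t u v E K : ℝ} (hσ : 0 < σ) (hσ1 : σ ≤ 1) (hu : 0 ≤ u) (hut : u ≤ t) (htv : t ≤ v)
    (hE : Real.exp (π * v / 4) ≤ E) (hK : 0 ≤ K)
    (hnum : ((σ + 1) * E) ^ 2 ≤ K ^ 2 * ((σ ^ 2 + u ^ 2 / 4) * ((σ + 1) ^ 2 + u ^ 2 / 4))) :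
    ‖Complex.Gamma (((σ : ℝ) : ℂ) + ((t / 2 : ℝ) : ℂ) * I)‖ * Real.exp (π * t / 4) ≤ K := by
  have ht0 : 0 ≤ t := hu.trans hut
  have hE0 : 0 ≤ E := (Real.exp_pos _).le.trans hE
  set Q : ℝ := (σ ^ 2 + (t / 2) ^ 2) * ((σ + 1) ^ 2 + (t / 2) ^ 2) with hQ
  set Qu : ℝ := (σ ^ 2 + u ^ 2 / 4) * ((σ + 1) ^ 2 + u ^ 2 / 4) with hQu
  have hQu0 : 0 < Qu := by positivity
  have hQuQ : Qu ≤ Q := by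
    have h1 : u ^ 2 / 4 ≤ (t / 2) ^ 2 := by nlinarith
    calc Qu = (σ ^ 2 + u ^ 2 / 4) * ((σ + 1) ^ 2 + u ^ 2 / 4) := rfl
      _ ≤ (σ ^ 2 + u ^ 2 / 4) * ((σ + 1) ^ 2 + (t / 2) ^ 2) := by gcongr
      _ ≤ (σ ^ 2 + (t / 2) ^ 2) * ((σ + 1) ^ 2 + (t / 2) ^ 2) := by gcongr
  have hQ0 : 0 < Q := hQu0.trans_le hQuQ
  have hsQ : 0 < Real.sqrt Q := Real.sqrt_pos.mpr hQ0
  -- `‖Γ(w)‖ ≤ (σ+1)/√Q`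
  have hG : ‖Complex.Gamma (((σ : ℝ) : ℂ) + ((t / 2 : ℝ) : ℂ) * I)‖ ≤ (σ + 1) / Real.sqrt Q := by
    have h := norm_Gamma_le_shift_two hσ (t / 2)
    rw [← Real.sqrt_mul (by positivity)] at h
    refine h.trans ?_
    gcongr
    exact Gamma_add_two_le hσ hσ1
  -- numerics: `(σ+1) E ≤ K √Qu ≤ K √Q`
  have hKE : (σ + 1) * E ≤ K * Real.sqrt Q := by
    have h1 : (σ + 1) * E ≤ Real.sqrt (K ^ 2 * Qu) := by
      rw [Real.le_sqrt (by positivity) (by positivity)]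
      exact hnum
    rw [Real.sqrt_mul' _ hQu0.le, Real.sqrt_sq hK] at h1
    exact h1.trans (by gcongr)
  have hexp : Real.exp (π * t / 4) ≤ E :=
    (Real.exp_le_exp.mpr (by gcongr)).trans hE
  calc ‖Complex.Gamma (((σ : ℝ) : ℂ) + ((t / 2 : ℝ) : ℂ) * I)‖ * Real.exp (π * t / 4)
      ≤ (σ + 1) / Real.sqrt Q * E := mul_le_mul hG hexp (Real.exp_pos _).le (by positivity)
    _ = (σ + 1) * E / Real.sqrt Q := by ring
    _ ≤ K * Real.sqrt Q / Real.sqrt Q := by gcongr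
    _ = K := by field_simp

/-! ### Rational enclosures of `e^x` -/

/-- `e^x ≤ 1 + x + x²/2 + x³/6 + x⁴/24 + x⁵/100` for `0 ≤ x ≤ 1` (Mathlib's `Real.exp_bound'`,
`n = 5`). [folklore] -/
private theorem exp_le_taylor {x : ℝ} (h0 : 0 ≤ x) (h1 : x ≤ 1) :
    Real.exp x ≤ 1 + x + x ^ 2 / 2 + x ^ 3 / 6 + x ^ 4 / 24 + x ^ 5 / 100 := by
  have h := Real.exp_bound' h0 h1 (n := 5) (by norm_num)
  have hs : ∑ m ∈ Finset.range 5, x ^ m / (m.factorial : ℝ) =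
      1 + x + x ^ 2 / 2 + x ^ 3 / 6 + x ^ 4 / 24 := by
    simp only [Finset.sum_range_succ, Finset.sum_range_zero, Nat.factorial]
    norm_num
  rw [hs] at h
  refine h.trans (le_of_eq ?_)
  norm_num [Nat.factorial]
  ring

/-- `e^x ≤ 2.7182818286 · (1 + y + y²/2 + y³/6 + y⁴/24 + y⁵/100)`, `y = x − 1`, for `1 ≤ x ≤ 2`.
[folklore] -/
private theorem exp_le_taylor' {x : ℝ} (h1 : 1 ≤ x) (h2 : x ≤ 2) :
    Real.exp x ≤ 2.7182818286 * (1 + (x - 1) + (x - 1) ^ 2 / 2 + (x - 1) ^ 3 / 6 +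
      (x - 1) ^ 4 / 24 + (x - 1) ^ 5 / 100) := by
  have h := exp_le_taylor (x := x - 1) (by linarith) (by linarith)
  have he : Real.exp x = Real.exp 1 * Real.exp (x - 1) := by
    rw [← Real.exp_add]; ring_nf
  rw [he]
  exact mul_le_mul Real.exp_one_lt_d9.le h (Real.exp_pos _).le (by norm_num)

/-- `e^{πv/4} ≤ 1 + x + … + x⁵/100` whenever `3.1416 v/4 ≤ x ≤ 1`, `v ≥ 0`. [folklore] -/
private theorem exp_pi_mul_le {v x : ℝ} (hv : 0 ≤ v) (hx : 3.1416 * v / 4 ≤ x) (hx1 : x ≤ 1) :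
    Real.exp (π * v / 4) ≤ 1 + x + x ^ 2 / 2 + x ^ 3 / 6 + x ^ 4 / 24 + x ^ 5 / 100 := by
  have hπ := Real.pi_lt_d4
  have h0 : 0 ≤ x := le_trans (by positivity) hx
  have hle : π * v / 4 ≤ x := by nlinarith
  exact (Real.exp_le_exp.mpr hle).trans (exp_le_taylor h0 hx1)

/-- `e^{πv/4} ≤ 2.7182818286 · (1 + (x−1) + …)` whenever `3.1416 v/4 ≤ x`, `1 ≤ x ≤ 2`, `v ≥ 0`.
[folklore] -/
private theorem exp_pi_mul_le' {v x : ℝ} (hv : 0 ≤ v) (hx : 3.1416 * v / 4 ≤ x) (hx1 : 1 ≤ x)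
    (hx2 : x ≤ 2) :
    Real.exp (π * v / 4) ≤ 2.7182818286 * (1 + (x - 1) + (x - 1) ^ 2 / 2 + (x - 1) ^ 3 / 6 +
      (x - 1) ^ 4 / 24 + (x - 1) ^ 5 / 100) := by
  have hπ := Real.pi_lt_d4
  have hle : π * v / 4 ≤ x := by nlinarith
  exact (Real.exp_le_exp.mpr hle).trans (exp_le_taylor' hx1 hx2)

/-- The printed constant `√(2π) e^{π/8+1/4} = 4.7666…` is at least `4.76` (`π > 3.141592`, the
exponential series to order 4). [cite: Platt2016GRH, Lemma 8.3 p. 3021 (the constant √(2π)e^{π/8+1/4})] -/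
theorem const_ge : (4.76 : ℝ) ≤ Real.sqrt (2 * π) * Real.exp (π / 8 + 1 / 4) := by
  have hπ := Real.pi_gt_d6
  have h1 : (2.50662 : ℝ) ≤ Real.sqrt (2 * π) := by
    rw [Real.le_sqrt (by norm_num) (by positivity)]
    nlinarith
  have h2 : (1.9 : ℝ) ≤ Real.exp (π / 8 + 1 / 4) := by
    set y : ℝ := π / 8 + 1 / 4 with hy
    have hy0 : (0.642699 : ℝ) ≤ y := by rw [hy]; linarith
    have hynn : 0 ≤ y := le_trans (by norm_num) hy0
    have hs := Real.sum_le_exp_of_nonneg hynn 5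
    have hs' : ∑ i ∈ Finset.range 5, y ^ i / (i.factorial : ℝ) =
        1 + y + y ^ 2 / 2 + y ^ 3 / 6 + y ^ 4 / 24 := by
      simp only [Finset.sum_range_succ, Finset.sum_range_zero, Nat.factorial]
      norm_num
    rw [hs'] at hs
    have hy2 : (0.642699 : ℝ) ^ 2 ≤ y ^ 2 := by gcongr
    have hy3 : (0.642699 : ℝ) ^ 3 ≤ y ^ 3 := by gcongr
    have hy4 : (0.642699 : ℝ) ^ 4 ≤ y ^ 4 := by gcongr
    nlinarith
  calc (4.76 : ℝ) ≤ 2.50662 * 1.9 := by norm_num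
    _ ≤ Real.sqrt (2 * π) * Real.exp (π / 8 + 1 / 4) :=
        mul_le_mul h1 h2 (by norm_num) (Real.sqrt_nonneg _)

/-! ### `t ≤ 0`: `|Γ(σ + it/2)| e^{πt/4} ≤ Γ(σ) ≤ 1/σ` -/

/-- For `0 < σ ≤ 1` and `t ≤ 0`: `‖Γ(σ+it/2)‖ e^{πt/4} ≤ 1/σ` (`|Γ(x+iy)| ≤ Γ(x) ≤ 1/x`,
`e^{πt/4} ≤ 1`) — the branch `t ≤ 0` of Platt's Lemma 8.3.
[cite: Platt2016GRH, Lemma 8.3 p. 3021 (case t ≤ 0)] [cite: DLMF, Eq. 5.6.6] -/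
theorem norm_Gamma_mul_exp_le_of_nonpos {σ t : ℝ} (hσ : 0 < σ) (hσ1 : σ ≤ 1) (ht : t ≤ 0) :
    ‖Complex.Gamma (((σ : ℝ) : ℂ) + ((t / 2 : ℝ) : ℂ) * I)‖ * Real.exp (π * t / 4) ≤ 1 / σ := by
  have hG : ‖Complex.Gamma (((σ : ℝ) : ℂ) + ((t / 2 : ℝ) : ℂ) * I)‖ ≤ 1 / σ :=
    (Literature.Analysis.SpecialFunctions.GammaVert.norm_Gamma_le_Gamma_re hσ (t / 2)).trans (Gamma_le_one_div hσ hσ1)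
  have hexp : Real.exp (π * t / 4) ≤ 1 := by
    rw [Real.exp_le_one_iff]
    nlinarith [Real.pi_pos]
  calc ‖Complex.Gamma (((σ : ℝ) : ℂ) + ((t / 2 : ℝ) : ℂ) * I)‖ * Real.exp (π * t / 4)
      ≤ 1 / σ * 1 := mul_le_mul hG hexp (Real.exp_pos _).le (by positivity)
    _ = 1 / σ := mul_one _

/-! ### `t ≥ 0`: the Stirling branch -/

/-- **Stirling branch.** For `σ > 0`, `τ ≥ 0` and `w = σ + iτ`:
`log ‖Γ(w)‖ + πτ/2 ≤ (σ − ½) log ‖w‖ + ½ log 2π + (1/12)(1/‖w‖² + π/(2‖w‖))`.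
From the tree's uniform Stirling formula `GammaStirling.abs_log_norm_Gamma_sub_le`
(`log‖Γ(w)‖ ≤ (σ−½)log‖w‖ − τ arg w − σ + ½log 2π + R(w)`) and `τ(π/2 − arg w) ≤ σ`
(`π/2 − arg w = φ` with `tan φ = σ/τ`, and `φ ≤ tan φ`) — "Stirling's approximation", the branch
`t ≥ 2` of Platt's Lemma 8.3, uniform in `σ > 0`.
[cite: Platt2016GRH, Lemma 8.3 p. 3021 (proof: Stirling's approximation)] [cite: WhittakerWatson1927, §12.33] -/
theorem log_norm_Gamma_add_le {σ τ : ℝ} (hσ : 0 < σ) (hτ : 0 ≤ τ) :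
    Real.log ‖Complex.Gamma (σ + τ * I)‖ + π * τ / 2 ≤
      (σ - 1 / 2) * Real.log ‖(σ : ℂ) + τ * I‖ + Real.log (2 * π) / 2 +
        (1 / 12) * (1 / ‖(σ : ℂ) + τ * I‖ ^ 2 + π / (2 * ‖(σ : ℂ) + τ * I‖)) := by
  set w : ℂ := σ + τ * I with hw
  have hre : w.re = σ := by simp [hw]
  have him : w.im = τ := by simp [hw]
  have hS := abs_log_norm_Gamma_sub_le (w := w) (by rw [hre]; exact hσ)
  rw [hre, him] at hS
  have h1 := (abs_le.mp hS).2
  -- key: `τ (π/2 − arg w) ≤ σ`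
  have hkey : τ * (π / 2) - τ * Complex.arg w ≤ σ := by
    rcases hτ.eq_or_lt with h0 | hpos
    · rw [← h0]; simpa using hσ.le
    · have harg_nn : 0 ≤ Complex.arg w := Complex.arg_nonneg_iff.mpr (by rw [him]; exact hpos.le)
      have harg_ne : Complex.arg w ≠ 0 := by
        intro h
        have := (Complex.arg_eq_zero_iff.mp h).2
        rw [him] at this
        linarith
      have harg_pos : 0 < Complex.arg w := lt_of_le_of_ne harg_nn (Ne.symm harg_ne)
      have harg_lt : Complex.arg w < π / 2 := by
        have := Complex.abs_arg_lt_pi_div_two_iff.mpr (Or.inl (by rw [hre]; exact hσ))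
        exact (abs_lt.mp this).2
      set φ : ℝ := π / 2 - Complex.arg w with hφ
      have hφ0 : 0 ≤ φ := by rw [hφ]; linarith
      have hφ1 : φ < π / 2 := by rw [hφ]; linarith
      have htan : Real.tan φ = σ / τ := by
        rw [hφ, Real.tan_pi_div_two_sub, Complex.tan_arg, hre, him, inv_div]
      have hle := Real.le_tan hφ0 hφ1
      rw [htan] at hle
      have : τ * φ ≤ σ := by
        calc τ * φ ≤ τ * (σ / τ) := by gcongr
          _ = σ := by field_simp
      rw [hφ, mul_sub] at this
      exact this
  linarith

/-- `log (‖Γ(w)‖ e^{πt/4}) = log ‖Γ(w)‖ + πt/4` and positivity, packaged: for `σ > 0`,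
`‖Γ(σ+it/2)‖ e^{πt/4} = exp(log ‖Γ(σ+it/2)‖ + πt/4)`. [folklore] -/
private theorem norm_Gamma_mul_exp_eq {σ : ℝ} (hσ : 0 < σ) (t : ℝ) :
    ‖Complex.Gamma (((σ : ℝ) : ℂ) + ((t / 2 : ℝ) : ℂ) * I)‖ * Real.exp (π * t / 4) =
      Real.exp (Real.log ‖Complex.Gamma (((σ : ℝ) : ℂ) + ((t / 2 : ℝ) : ℂ) * I)‖ + π * t / 4) := by
  have hpos : 0 < ‖Complex.Gamma (((σ : ℝ) : ℂ) + ((t / 2 : ℝ) : ℂ) * I)‖ := by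
    have hre : ((((σ : ℝ) : ℂ) + ((t / 2 : ℝ) : ℂ) * I)).re = σ := by simp
    exact norm_pos_iff.mpr (Complex.Gamma_ne_zero_of_re_pos (by rw [hre]; exact hσ))
  rw [Real.exp_add, Real.exp_log hpos]

/-- `‖σ + it/2‖ = √(σ² + t²/4)`. [folklore] -/
private theorem norm_w_eq {σ t : ℝ} :
    ‖(((σ : ℝ) : ℂ) + ((t / 2 : ℝ) : ℂ) * I)‖ = Real.sqrt (σ ^ 2 + (t / 2) ^ 2) :=
  Complex.norm_add_mul_I σ (t / 2)

/-- **Odd case, `t ≥ 2`** (`σ = 3/4`): `‖Γ(3/4+it/2)‖ e^{πt/4} ≤ √π (3+2t)^{1/4} e^{1/6}` — the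
first term of Platt's maximum; Stirling with `‖w‖ ≥ 5/4` (so the remainder is `≤ 0.158 < 1/6`) and
`‖w‖ ≤ (3+2t)/4`. [cite: Platt2016GRH, Lemma 8.3 p. 3021 (case a_χ = 1, large t)] -/
theorem odd_of_two_le {t : ℝ} (ht : 2 ≤ t) :
    ‖Complex.Gamma ((((3 / 4 : ℝ)) : ℂ) + ((t / 2 : ℝ) : ℂ) * I)‖ * Real.exp (π * t / 4) ≤
      Real.sqrt π * (3 + 2 * t) ^ (1 / 4 : ℝ) * Real.exp (1 / 6) := by
  have ht0 : 0 ≤ t := by linarith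
  set n : ℝ := ‖(((3 / 4 : ℝ)) : ℂ) + ((t / 2 : ℝ) : ℂ) * I‖ with hn
  have hn_eq : n = Real.sqrt ((3 / 4) ^ 2 + (t / 2) ^ 2) := norm_w_eq
  have hn_ge : 5 / 4 ≤ n := by
    rw [hn_eq, Real.le_sqrt (by norm_num) (by positivity)]
    nlinarith
  have hn_pos : 0 < n := by linarith
  have hn_le : n ≤ (3 + 2 * t) / 4 := by
    rw [hn]
    refine (norm_add_le _ _).trans ?_
    rw [norm_mul, Complex.norm_I, mul_one, Complex.norm_real, Complex.norm_real,
      Real.norm_of_nonneg (by norm_num), Real.norm_of_nonneg (by linarith)]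
    linarith
  have hlog := log_norm_Gamma_add_le (σ := 3 / 4) (τ := t / 2) (by norm_num) (by linarith)
  rw [← hn] at hlog
  -- the remainder is at most `1/6`
  have hR : (1 / 12 : ℝ) * (1 / n ^ 2 + π / (2 * n)) ≤ 1 / 6 := by
    have hπ := Real.pi_lt_d4
    have h1 : 1 / n ^ 2 ≤ 16 / 25 := by
      rw [div_le_div_iff₀ (by positivity) (by norm_num)]
      nlinarith
    have h2 : π / (2 * n) ≤ 3.1416 / (2 * (5 / 4)) := by
      gcongr
    linarith [h1, h2]
  -- `(1/4) log n ≤ (1/4) log ((3+2t)/4)`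
  have hlogn : Real.log n ≤ Real.log ((3 + 2 * t) / 4) := Real.log_le_log hn_pos hn_le
  have hmain : Real.log ‖Complex.Gamma ((((3 / 4 : ℝ)) : ℂ) + ((t / 2 : ℝ) : ℂ) * I)‖ + π * t / 4 ≤
      (1 / 4) * Real.log (3 + 2 * t) + Real.log π / 2 + 1 / 6 := by
    have hsplit : Real.log ((3 + 2 * t) / 4) = Real.log (3 + 2 * t) - 2 * Real.log 2 := by
      rw [Real.log_div (by linarith) (by norm_num), show (4 : ℝ) = 2 ^ 2 by norm_num, Real.log_pow]
      ring
    have h2π : Real.log (2 * π) = Real.log 2 + Real.log π :=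
      Real.log_mul (by norm_num) Real.pi_pos.ne'
    have hτ : π * (t / 2) / 2 = π * t / 4 := by ring
    rw [hτ] at hlog
    nlinarith [hlog, hR, hlogn, hsplit, h2π]
  rw [norm_Gamma_mul_exp_eq (by norm_num)]
  calc Real.exp (Real.log ‖Complex.Gamma ((((3 / 4 : ℝ)) : ℂ) + ((t / 2 : ℝ) : ℂ) * I)‖ + π * t / 4)
      ≤ Real.exp ((1 / 4) * Real.log (3 + 2 * t) + Real.log π / 2 + 1 / 6) :=
        Real.exp_le_exp.mpr hmain
    _ = Real.sqrt π * (3 + 2 * t) ^ (1 / 4 : ℝ) * Real.exp (1 / 6) := by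
        rw [Real.exp_add, Real.exp_add, Real.rpow_def_of_pos (by linarith : (0 : ℝ) < 3 + 2 * t),
          Real.sqrt_eq_rpow, Real.rpow_def_of_pos Real.pi_pos]
        ring_nf

/-- **Even case, `t ≥ 2`** (`σ = 1/4`): `‖Γ(1/4+it/2)‖ e^{πt/4} ≤ √(2π) e^{π/8+1/4}` — the second
term of Platt's maximum; Stirling with `‖w‖ ≥ 1` (`−¼ log ‖w‖ ≤ 0`, remainder `≤ (1+π/2)/12`).
[cite: Platt2016GRH, Lemma 8.3 p. 3021 (case a_χ = 0, large t)] -/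
theorem even_of_two_le {t : ℝ} (ht : 2 ≤ t) :
    ‖Complex.Gamma ((((1 / 4 : ℝ)) : ℂ) + ((t / 2 : ℝ) : ℂ) * I)‖ * Real.exp (π * t / 4) ≤
      Real.sqrt (2 * π) * Real.exp (π / 8 + 1 / 4) := by
  have ht0 : 0 ≤ t := by linarith
  set n : ℝ := ‖(((1 / 4 : ℝ)) : ℂ) + ((t / 2 : ℝ) : ℂ) * I‖ with hn
  have hn_eq : n = Real.sqrt ((1 / 4) ^ 2 + (t / 2) ^ 2) := norm_w_eq
  have hn_ge : 1 ≤ n := by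
    rw [hn_eq, Real.le_sqrt (by norm_num) (by positivity)]
    nlinarith
  have hn_pos : 0 < n := by linarith
  have hlog := log_norm_Gamma_add_le (σ := 1 / 4) (τ := t / 2) (by norm_num) (by linarith)
  rw [← hn] at hlog
  have hR : (1 / 12 : ℝ) * (1 / n ^ 2 + π / (2 * n)) ≤ π / 8 + 1 / 4 := by
    have h1 : 1 / n ^ 2 ≤ 1 := by
      rw [div_le_one (by positivity)]
      nlinarith
    have h2 : π / (2 * n) ≤ π / 2 := by
      apply div_le_div_of_nonneg_left Real.pi_pos.le (by norm_num)
      linarith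
    nlinarith [h1, h2, Real.pi_pos]
  have hlogn : 0 ≤ Real.log n := Real.log_nonneg hn_ge
  have hmain : Real.log ‖Complex.Gamma ((((1 / 4 : ℝ)) : ℂ) + ((t / 2 : ℝ) : ℂ) * I)‖ + π * t / 4 ≤
      Real.log (2 * π) / 2 + (π / 8 + 1 / 4) := by
    have hτ : π * (t / 2) / 2 = π * t / 4 := by ring
    rw [hτ] at hlog
    nlinarith [hlog, hR, hlogn]
  rw [norm_Gamma_mul_exp_eq (by norm_num)]
  calc Real.exp (Real.log ‖Complex.Gamma ((((1 / 4 : ℝ)) : ℂ) + ((t / 2 : ℝ) : ℂ) * I)‖ + π * t / 4)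
      ≤ Real.exp (Real.log (2 * π) / 2 + (π / 8 + 1 / 4)) := Real.exp_le_exp.mpr hmain
    _ = Real.sqrt (2 * π) * Real.exp (π / 8 + 1 / 4) := by
        rw [Real.exp_add, Real.sqrt_eq_rpow, Real.rpow_def_of_pos (by positivity)]
        ring_nf

/-! ### `0 ≤ t ≤ 2`: the mesh -/

/-- **Even case, `0 ≤ t ≤ 2`** (`σ = 1/4`): `‖Γ(1/4+it/2)‖ e^{πt/4} ≤ 4.76`, by nine cells of
`GammaFactorBound.cell` (breakpoints `0, 0.2, 0.3, 0.4, 0.55, 0.74, 1, 1.3, 1.65, 2`; `Γ(9/4) ≤ 5/4`).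
[cite: Platt2016GRH, Lemma 8.3 p. 3021 (case a_χ = 0, small t)] -/
theorem even_of_le_two {t : ℝ} (ht0 : 0 ≤ t) (ht2 : t ≤ 2) :
    ‖Complex.Gamma ((((1 / 4 : ℝ)) : ℂ) + ((t / 2 : ℝ) : ℂ) * I)‖ * Real.exp (π * t / 4) ≤ 4.76 := by
  have hσ : (0 : ℝ) < 1 / 4 := by norm_num
  have hσ1 : (1 / 4 : ℝ) ≤ 1 := by norm_num
  have hK : (0 : ℝ) ≤ 4.76 := by norm_num
  rcases le_or_gt t (1 / 5) with h1 | h1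
  · exact cell hσ hσ1 le_rfl ht0 h1
      (exp_pi_mul_le (x := 3.1416 * (1 / 5) / 4) (by norm_num) le_rfl (by norm_num)) hK (by norm_num)
  rcases le_or_gt t (3 / 10) with h2 | h2
  · exact cell hσ hσ1 (by norm_num) h1.le h2
      (exp_pi_mul_le (x := 3.1416 * (3 / 10) / 4) (by norm_num) le_rfl (by norm_num)) hK (by norm_num)
  rcases le_or_gt t (2 / 5) with h3 | h3
  · exact cell hσ hσ1 (by norm_num) h2.le h3
      (exp_pi_mul_le (x := 3.1416 * (2 / 5) / 4) (by norm_num) le_rfl (by norm_num)) hK (by norm_num)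
  rcases le_or_gt t (11 / 20) with h4 | h4
  · exact cell hσ hσ1 (by norm_num) h3.le h4
      (exp_pi_mul_le (x := 3.1416 * (11 / 20) / 4) (by norm_num) le_rfl (by norm_num)) hK (by norm_num)
  rcases le_or_gt t (37 / 50) with h5 | h5
  · exact cell hσ hσ1 (by norm_num) h4.le h5
      (exp_pi_mul_le (x := 3.1416 * (37 / 50) / 4) (by norm_num) le_rfl (by norm_num)) hK (by norm_num)
  rcases le_or_gt t 1 with h6 | h6
  · exact cell hσ hσ1 (by norm_num) h5.le h6
      (exp_pi_mul_le (x := 3.1416 * 1 / 4) (by norm_num) le_rfl (by norm_num)) hK (by norm_num)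
  rcases le_or_gt t (13 / 10) with h7 | h7
  · exact cell hσ hσ1 (by norm_num) h6.le h7
      (exp_pi_mul_le' (x := 3.1416 * (13 / 10) / 4) (by norm_num) le_rfl (by norm_num) (by norm_num))
      hK (by norm_num)
  rcases le_or_gt t (33 / 20) with h8 | h8
  · exact cell hσ hσ1 (by norm_num) h7.le h8
      (exp_pi_mul_le' (x := 3.1416 * (33 / 20) / 4) (by norm_num) le_rfl (by norm_num) (by norm_num))
      hK (by norm_num)
  · exact cell hσ hσ1 (by norm_num) h8.le ht2
      (exp_pi_mul_le' (x := 3.1416 * 2 / 4) (by norm_num) le_rfl (by norm_num) (by norm_num))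
      hK (by norm_num)

/-- **Odd case, `0 ≤ t ≤ 2`** (`σ = 3/4`): `‖Γ(3/4+it/2)‖ e^{πt/4} ≤ 4.76`, by two cells
(breakpoints `0, 1.5, 2`; `Γ(11/4) ≤ 7/4`). [cite: Platt2016GRH, Lemma 8.3 p. 3021 (case a_χ = 1, small t)] -/
theorem odd_of_le_two {t : ℝ} (ht0 : 0 ≤ t) (ht2 : t ≤ 2) :
    ‖Complex.Gamma ((((3 / 4 : ℝ)) : ℂ) + ((t / 2 : ℝ) : ℂ) * I)‖ * Real.exp (π * t / 4) ≤ 4.76 := by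
  have hσ : (0 : ℝ) < 3 / 4 := by norm_num
  have hσ1 : (3 / 4 : ℝ) ≤ 1 := by norm_num
  have hK : (0 : ℝ) ≤ 4.76 := by norm_num
  rcases le_or_gt t (3 / 2) with h1 | h1
  · exact cell hσ hσ1 le_rfl ht0 h1
      (exp_pi_mul_le' (x := 3.1416 * (3 / 2) / 4) (by norm_num) le_rfl (by norm_num) (by norm_num))
      hK (by norm_num)
  · exact cell hσ hσ1 (by norm_num) h1.le ht2
      (exp_pi_mul_le' (x := 3.1416 * 2 / 4) (by norm_num) le_rfl (by norm_num) (by norm_num))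
      hK (by norm_num)

end GammaFactorBound

open GammaFactorBound

/-! ## Lemma 8.3 as printed -/

/-- **Platt 2016, Lemma 8.3 (Math. Comp. 85, p. 3021; arXiv:1305.3087v1 Lemma 6.3), as printed:**
"For `a_χ ∈ {0, 1}`,
`|Γ((1/2 + it + a_χ)/2)| e^{πt/4} ≤ max(√π (3 + max(2t, 0))^{1/4} e^{1/6}, √(2π) exp(π/8 + 1/4))`."
(arXiv v1 writes the first term as `2^{1/4}√π (3/2 + max(t,0))^{1/4} exp(1/6)`, the same number.)
Here `t ∈ ℝ` is arbitrary, `a = a_χ` is a natural number `≤ 1`, `Γ` = Mathlib's `Complex.Gamma`,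
`x^{1/4}` = `Real.rpow`. Printed proof: "We use Stirling's approximation separately for `a_χ = 0` and
`a_χ = 1`." Proof here (see the module docstring): the tree's uniform Stirling bound for `t ≥ 2`, the
shift `Γ(w) = Γ(w+2)/(w(w+1))` on a rational mesh for `0 ≤ t ≤ 2`, `|Γ(w)| ≤ Γ(Re w)` for `t ≤ 0`.
[cite: Platt2016GRH, Lemma 8.3 p. 3021] -/
theorem platt2016_lemma83 {a : ℕ} (ha : a ≤ 1) (t : ℝ) :
    ‖Complex.Gamma ((1 / 2 + I * t + a) / 2)‖ * Real.exp (π * t / 4) ≤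
      max (Real.sqrt π * (3 + max (2 * t) 0) ^ (1 / 4 : ℝ) * Real.exp (1 / 6))
        (Real.sqrt (2 * π) * Real.exp (π / 8 + 1 / 4)) := by
  have hK := const_ge
  interval_cases a
  · -- `a = 0`, `σ = 1/4`
    have hw : (1 / 2 + I * t + ((0 : ℕ) : ℂ)) / 2 = (((1 / 4 : ℝ)) : ℂ) + ((t / 2 : ℝ) : ℂ) * I := by
      push_cast; ring
    rw [hw]
    refine le_trans ?_ (le_max_right _ _)
    rcases le_or_gt t 0 with ht | ht
    · exact (norm_Gamma_mul_exp_le_of_nonpos (by norm_num) (by norm_num) ht).trans (by linarith)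
    rcases le_or_gt 2 t with ht2 | ht2
    · exact even_of_two_le ht2
    · exact (even_of_le_two ht.le ht2.le).trans hK
  · -- `a = 1`, `σ = 3/4`
    have hw : (1 / 2 + I * t + ((1 : ℕ) : ℂ)) / 2 = (((3 / 4 : ℝ)) : ℂ) + ((t / 2 : ℝ) : ℂ) * I := by
      push_cast; ring
    rw [hw]
    rcases le_or_gt t 0 with ht | ht
    · refine le_trans ?_ (le_max_right _ _)
      exact (norm_Gamma_mul_exp_le_of_nonpos (by norm_num) (by norm_num) ht).trans (by linarith)
    rcases le_or_gt 2 t with ht2 | ht2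
    · refine le_trans ?_ (le_max_left _ _)
      rw [max_eq_left (by linarith : (0 : ℝ) ≤ 2 * t)]
      exact odd_of_two_le ht2
    · refine le_trans ?_ (le_max_right _ _)
      exact (odd_of_le_two ht.le ht2.le).trans hK

/-- **Lemma 8.3, arXiv form of the constant** (arXiv:1305.3087v1 Lemma 6.3): the same bound with the
first term written `2^{1/4} √π (3/2 + max(t, 0))^{1/4} e^{1/6}` (`= √π (3 + max(2t,0))^{1/4} e^{1/6}`).
[cite: Platt2016GRH, Lemma 8.3 p. 3021] -/
theorem platt2016_lemma83_arxiv {a : ℕ} (ha : a ≤ 1) (t : ℝ) :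
    ‖Complex.Gamma ((1 / 2 + I * t + a) / 2)‖ * Real.exp (π * t / 4) ≤
      max ((2 : ℝ) ^ (1 / 4 : ℝ) * Real.sqrt π * (3 / 2 + max t 0) ^ (1 / 4 : ℝ) * Real.exp (1 / 6))
        (Real.sqrt (2 * π) * Real.exp (π / 8 + 1 / 4)) := by
  have h := platt2016_lemma83 ha t
  have hm : (3 : ℝ) + max (2 * t) 0 = 2 * (3 / 2 + max t 0) := by
    rcases le_total t 0 with ht | ht
    · rw [max_eq_right (by linarith : 2 * t ≤ 0), max_eq_right ht]; ring
    · rw [max_eq_left (by linarith : (0 : ℝ) ≤ 2 * t), max_eq_left ht]; ring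
  have hm0 : (0 : ℝ) ≤ 3 / 2 + max t 0 := by positivity
  rw [hm, Real.mul_rpow (by norm_num) hm0] at h
  convert h using 2
  ring

/-- **Lemma 8.3, even characters** (`a_χ = 0`): `|Γ((1/2+it)/2)| e^{πt/4} ≤ max(…)` for all real `t`.
[cite: Platt2016GRH, Lemma 8.3 p. 3021] -/
theorem platt2016_lemma83_even (t : ℝ) :
    ‖Complex.Gamma ((1 / 2 + I * t) / 2)‖ * Real.exp (π * t / 4) ≤
      max (Real.sqrt π * (3 + max (2 * t) 0) ^ (1 / 4 : ℝ) * Real.exp (1 / 6))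
        (Real.sqrt (2 * π) * Real.exp (π / 8 + 1 / 4)) := by
  have h := platt2016_lemma83 (a := 0) (by norm_num) t
  simpa using h

/-- **Lemma 8.3, odd characters** (`a_χ = 1`): `|Γ((3/2+it)/2)| e^{πt/4} ≤ max(…)` for all real `t`.
[cite: Platt2016GRH, Lemma 8.3 p. 3021] -/
theorem platt2016_lemma83_odd (t : ℝ) :
    ‖Complex.Gamma ((3 / 2 + I * t) / 2)‖ * Real.exp (π * t / 4) ≤
      max (Real.sqrt π * (3 + max (2 * t) 0) ^ (1 / 4 : ℝ) * Real.exp (1 / 6))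
        (Real.sqrt (2 * π) * Real.exp (π / 8 + 1 / 4)) := by
  have h := platt2016_lemma83 (a := 1) le_rfl t
  have hw : (1 / 2 + I * t + ((1 : ℕ) : ℂ)) / 2 = (3 / 2 + I * t) / 2 := by push_cast; ring
  rw [hw] at h
  exact h

/-- **Lemma 8.3 for the parity `a_χ = charParity χ` of a Dirichlet character** (the Gamma factor of
Platt's `Λ_χ(t) = ε_χ (q/π)^{it/2} Γ((1/2 + a_χ + it)/2) e^{πt/4} L_χ(1/2+it)`, p. 3009, in the
argument order used by `platt2016_lemma85`). [cite: Platt2016GRH, Lemma 8.3 p. 3021] -/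
theorem platt2016_lemma83_charParity {q : ℕ} (χ : DirichletCharacter ℂ q) (t : ℝ) :
    ‖Complex.Gamma ((1 / 2 + charParity χ + I * t) / 2)‖ * Real.exp (π * t / 4) ≤
      max (Real.sqrt π * (3 + max (2 * t) 0) ^ (1 / 4 : ℝ) * Real.exp (1 / 6))
        (Real.sqrt (2 * π) * Real.exp (π / 8 + 1 / 4)) := by
  have h := platt2016_lemma83 (charParity_le_one χ) t
  have hw : (1 / 2 + I * t + ((charParity χ : ℕ) : ℂ)) / 2 = (1 / 2 + charParity χ + I * t) / 2 := by
    ring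
  rw [hw] at h
  exact h

/-- **Lemma 8.3 for `t ≥ 0`** (both parities): the bound with `max(2t, 0) = 2t`.
[cite: Platt2016GRH, Lemma 8.3 p. 3021] -/
theorem platt2016_lemma83_of_nonneg {a : ℕ} (ha : a ≤ 1) {t : ℝ} (ht : 0 ≤ t) :
    ‖Complex.Gamma ((1 / 2 + I * t + a) / 2)‖ * Real.exp (π * t / 4) ≤
      max (Real.sqrt π * (3 + 2 * t) ^ (1 / 4 : ℝ) * Real.exp (1 / 6))
        (Real.sqrt (2 * π) * Real.exp (π / 8 + 1 / 4)) := by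
  have h := platt2016_lemma83 ha t
  rwa [max_eq_left (by linarith : (0 : ℝ) ≤ 2 * t)] at h

end Literature.NumberTheory.LFunctions

end
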